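import Summits.Ventures.PercRepro.ProfilePointedCircuitClassesThreeCocircuitB
import Summits.Ventures.PercRepro.ProfilePointedCircuitClassesTop
import Summits.Ventures.PercRepro.ProfilePointedCircuitClassesFiveTop
import Summits.Ventures.PercRepro.ProfilePointedCircuitClassesSevenE
import Summits.Ventures.PercRepro.ProfilePointedCircuitClassesFiveSeriesMem
import Summits.Ventures.PercRepro.ProfilePointedCircuitClassesFourteenSeries

/-!
# PercRepro — A POINT OF A 3-COCIRCUIT, PART C: THE HYPOTHESIS OF PART B IS A KERNEL THEOREM; THE TWELVE-POINT
STATEMENT AT EVERY POINT OF COGIRTH `≤ 3` (p5, gen 49; `proofs/P5-GM1.md` §73 ADDENDUM 2)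

Part B (§72) took `out_4(q) ≤ in_5(q)` on the ten-point minor `N ／ p ∖ e` as a hypothesis, calling it the cell's
open `BiIndepPointed`.  It is not open: `outCount_four_le_inCount_five_of_nullity_four` (gen 36, §52) proves
`out_4(x) ≤ in_5(x)` on every matroid of nullity `4` and rank `≥ 6`, and the minor has ten points and rank
exactly `6` (`ρ(E − e) = 7` from `ρ(E − e − p) = 7`).  So the 3-cocircuit regime is unconditional
(`inCount_five_le_outCount_six_of_threeCocircuit'`), and with the coloop case (§65) and the series-pair case (§66)
the twelve-point statement holds at every point lying in a cocircuit of at most three points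
(`inCount_five_le_outCount_six_of_mem_cocircuit_card_le_three`): what is left of `InOutBottomTwelve` is exactly
the points of cogirth `≥ 4`.  Also recorded: the nullity-`5` per-point form `out_5(x) ≤ in_6(x)` is unconditional
(`outCount_five_le_inCount_six_of_nullity_five`: gen 37's reduction, §53, with gen 41's `inOutBottomFour_holds`, §61).
-/

open scoped Matroid

namespace PercRepro.Cogirth

open Finset ThmH Skew Shadow Profile

variable {α : Type} [DecidableEq α] {N : Matroid α} [N.Finite]

section ThreeCocircuitC

/-- **THE PER-POINT FORM OF THEOREM A AT NULLITY `5` IS UNCONDITIONAL**: `out_5(x) ≤ in_6(x)` on every matroid with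
`#E = ρ(E) + 5` and `ρ(E) ≥ 7` — §53's reduction (`outCount_five_le_inCount_six_of_nullity_five_of_inout`) with
§61's `inOutBottomFour_holds`. -/
theorem outCount_five_le_inCount_six_of_nullity_five (hn : (gr N).card = rk N (gr N) + 5)
    (hR : 7 ≤ rk N (gr N)) {x : α} (hx : x ∈ gr N) : outCount N 5 x ≤ inCount N 6 x :=
  outCount_five_le_inCount_six_of_nullity_five_of_inout inOutBottomFour_holds hn hR hx

/-- **THE 3-COCIRCUIT REGIME OF THE TWELVE-POINT STATEMENT, UNCONDITIONAL**: `#E = 12`, `ρ(E) = 7`, `{e, p, q}` a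
cocircuit no pair of which is a cocircuit; then `in_5(e) ≤ out_6(e)`.  The hypothesis of part B holds on the
minor `N ／ p ∖ e` (ten points, rank `6`) by §52's `outCount_four_le_inCount_five_of_nullity_four`. -/
theorem inCount_five_le_outCount_six_of_threeCocircuit' (hn : (gr N).card = 12) (hR : rk N (gr N) = 7)
    {e p q : α} (he : e ∈ gr N) (hp : p ∈ gr N) (hq : q ∈ gr N) (hep : e ≠ p) (heq : e ≠ q) (hpq : p ≠ q)
    (hcoc : rk N ((((gr N).erase e).erase p).erase q) = 6) (hc1 : rk N (((gr N).erase e).erase p) = 7)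
    (hc2 : rk N (((gr N).erase e).erase q) = 7) (hc3 : rk N (((gr N).erase p).erase q) = 7) :
    inCount N 5 e ≤ outCount N 6 e := by
  apply inCount_five_le_outCount_six_of_threeCocircuit hn hR he hp hq hep heq hpq hcoc hc1 hc2 hc3
  have hgr := gr_minor_eq (N := N) p e
  have hq2 : q ∈ gr ((N ／ ({p} : Set α)) ＼ ({e} : Set α)) := by
    rw [hgr]; exact mem_erase.2 ⟨heq.symm, mem_erase.2 ⟨hpq.symm, hq⟩⟩
  have hcard : (gr ((N ／ ({p} : Set α)) ＼ ({e} : Set α))).card = 10 := by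
    rw [hgr, card_erase_of_mem (mem_erase.2 ⟨hep, he⟩), card_erase_of_mem hp, hn]
  have hp1 : rk N {p} = 1 := by
    have h := (hyperplane_facts_of_threeCocircuit he hp hq hep heq hpq hcoc hc1 hc2 hc3
      (X := ∅) (empty_subset _)).2.1
    rw [rk_empty_eq_zero, insert_empty] at h
    exact h
  -- the minor has rank exactly `6`: `ρ(E − e) = 7` from `ρ(E − e − p) = 7`
  have hrk : rk ((N ／ ({p} : Set α)) ＼ ({e} : Set α)) (gr ((N ／ ({p} : Set α)) ＼ ({e} : Set α))) = 6 := by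
    have h1 := rk_minor_add_one (N := N) (x := p) (w := e) hp1 (subset_refl _)
    have h1' : insert p (gr ((N ／ ({p} : Set α)) ＼ ({e} : Set α))) = (gr N).erase e := by
      rw [hgr, erase_right_comm, insert_erase (mem_erase.2 ⟨hep.symm, hp⟩)]
    rw [h1'] at h1
    have h2 := rk_mono' (M := N) (erase_subset e (gr N))
    have h3 := rk_mono' (M := N) (erase_subset p ((gr N).erase e))
    rw [hR] at h2
    rw [hc1] at h3
    omega
  exact outCount_four_le_inCount_five_of_nullity_four (by rw [hcard, hrk]) (by rw [hrk]) hq2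

/-- `E ∖ {x, y} = (E − x) − y`. -/
theorem sdiff_pair_eq (s : Finset α) (x y : α) : s \ {x, y} = (s.erase x).erase y := by
  ext t
  simp only [mem_sdiff, mem_insert, mem_singleton, mem_erase, not_or]
  tauto

/-- `E ∖ {x, y, z} = ((E − x) − y) − z`. -/
theorem sdiff_triple_eq (s : Finset α) (x y z : α) : s \ {x, y, z} = ((s.erase x).erase y).erase z := by
  ext t
  simp only [mem_sdiff, mem_insert, mem_singleton, mem_erase, not_or]
  tauto

/-- **A SERIES PAIR FROM A 2-COCIRCUIT**: `ρ(E − e − p) < ρ(E)` with `e, p` non-coloops. -/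
theorem seriesPair_of_rk_erase_erase_lt {e p : α} (he : e ∈ gr N) (hp : p ∈ gr N) (hep : e ≠ p)
    (h1 : rk N ((gr N).erase e) = rk N (gr N)) (h2 : rk N ((gr N).erase p) = rk N (gr N))
    (h3 : rk N (((gr N).erase e).erase p) < rk N (gr N)) : SeriesPair N e p := by
  refine ⟨he, hp, hep, h1, h2, ?_⟩
  have h4 := rk_insert_le_add_one (N := N) (z := p) hp (X := ((gr N).erase e).erase p)
    ((erase_subset p _).trans (erase_subset e _))
  rw [insert_erase (mem_erase.2 ⟨hep.symm, hp⟩), h1] at h4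
  omega

/-- **THE 3-COCIRCUIT CASE, `e` FIRST**: `D = {e, p, q}` a cocircuit (`ρ(E ∖ D) < 7`, every `D − d` spanning). -/
theorem inCount_five_le_outCount_six_of_threeCocircuit_triple (hn : (gr N).card = 12) (hR : rk N (gr N) = 7)
    {e p q : α} (he : e ∈ gr N) (hp : p ∈ gr N) (hq : q ∈ gr N) (hep : e ≠ p) (heq : e ≠ q) (hpq : p ≠ q)
    (hDr : rk N (gr N \ {e, p, q}) < 7)
    (hmin : ∀ d ∈ ({e, p, q} : Finset α), rk N (gr N \ ({e, p, q} : Finset α).erase d) = 7) :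
    inCount N 5 e ≤ outCount N 6 e := by
  have h1 := hmin e (mem_insert_self e _)
  have h2 := hmin p (mem_insert_of_mem (mem_insert_self p _))
  have h3 := hmin q (mem_insert_of_mem (mem_insert_of_mem (mem_singleton_self q)))
  have e1 : ({e, p, q} : Finset α).erase e = {p, q} := by
    rw [erase_insert]
    rw [mem_insert, mem_singleton, not_or]
    exact ⟨hep, heq⟩
  have e2 : ({e, p, q} : Finset α).erase p = {e, q} := by
    ext t
    simp only [mem_erase, mem_insert, mem_singleton]
    constructor
    · rintro ⟨htp, h | h | h⟩
      · exact Or.inl h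
      · exact absurd h htp
      · exact Or.inr h
    · rintro (rfl | rfl)
      · exact ⟨hep, Or.inl rfl⟩
      · exact ⟨hpq.symm, Or.inr (Or.inr rfl)⟩
  have e3 : ({e, p, q} : Finset α).erase q = {e, p} := by
    ext t
    simp only [mem_erase, mem_insert, mem_singleton]
    constructor
    · rintro ⟨htq, h | h | h⟩
      · exact Or.inl h
      · exact Or.inr h
      · exact absurd h htq
    · rintro (rfl | rfl)
      · exact ⟨heq, Or.inl rfl⟩
      · exact ⟨hpq, Or.inr (Or.inl rfl)⟩
  rw [e1, sdiff_pair_eq] at h1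
  rw [e2, sdiff_pair_eq] at h2
  rw [e3, sdiff_pair_eq] at h3
  rw [sdiff_triple_eq] at hDr
  have hcoc : rk N ((((gr N).erase e).erase p).erase q) = 6 := by
    have h4 := rk_insert_le_add_one (N := N) (z := q) hq (X := (((gr N).erase e).erase p).erase q)
      ((erase_subset q _).trans ((erase_subset p _).trans (erase_subset e _)))
    rw [insert_erase (mem_erase.2 ⟨hpq.symm, mem_erase.2 ⟨heq.symm, hq⟩⟩), h3] at h4
    omega
  exact inCount_five_le_outCount_six_of_threeCocircuit' hn hR he hp hq hep heq hpq hcoc h3 h2 h1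

/-- **THE TWELVE-POINT STATEMENT AT EVERY POINT OF COGIRTH `≤ 3`**: `#E = 12`, `ρ(E) = 7`, `D` a cocircuit
(`ρ(E ∖ D) < ρ(E)` and `ρ(E ∖ (D − d)) = ρ(E)` for every `d ∈ D`) with `#D ≤ 3` and `e ∈ D`; then
`in_5(e) ≤ out_6(e)` — the coloop case (`#D = 1`), the series-pair case (`#D = 2`), the 3-cocircuit case. -/
theorem inCount_five_le_outCount_six_of_mem_cocircuit_card_le_three (hn : (gr N).card = 12) (hR : rk N (gr N) = 7)
    {D : Finset α} (hD : D ⊆ gr N) (hDr : rk N (gr N \ D) < 7) (hmin : ∀ d ∈ D, rk N (gr N \ D.erase d) = 7)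
    (hD3 : D.card ≤ 3) {e : α} (he : e ∈ D) : inCount N 5 e ≤ outCount N 6 e := by
  have heg : e ∈ gr N := hD he
  have hpos : 0 < D.card := card_pos.2 ⟨e, he⟩
  rcases Nat.lt_or_ge D.card 2 with h2 | h2
  · -- `#D = 1`: `e` is a coloop
    have hD1 : D = {e} := by
      symm
      apply eq_of_subset_of_card_le (singleton_subset_iff.2 he)
      rw [card_singleton]
      omega
    rw [hD1, sdiff_singleton_eq_erase] at hDr
    exact inCount_five_le_outCount_six_of_twelve_of_coloop (by omega) hR heg (by omega) heg
  rcases Nat.lt_or_ge D.card 3 with h3 | h3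
  · -- `#D = 2`: a series pair through `e`
    have hD2 : D.card = 2 := by omega
    obtain ⟨x, y, hxy, rfl⟩ := card_eq_two.1 hD2
    have hx : x ∈ gr N := hD (mem_insert_self x _)
    have hy : y ∈ gr N := hD (mem_insert_of_mem (mem_singleton_self y))
    have hmx := hmin x (mem_insert_self x _)
    have hmy := hmin y (mem_insert_of_mem (mem_singleton_self y))
    rw [erase_insert (by rw [mem_singleton]; exact hxy), sdiff_singleton_eq_erase] at hmx
    have ey : ({x, y} : Finset α).erase y = {x} := by
      rw [pair_comm, erase_insert (by rw [mem_singleton]; exact hxy.symm)]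
    rw [ey, sdiff_singleton_eq_erase] at hmy
    rw [sdiff_pair_eq] at hDr
    rw [mem_insert, mem_singleton] at he
    rcases he with rfl | rfl
    · exact inCount_five_le_outCount_six_of_twelve_of_seriesPair_mem hn hR
        (seriesPair_of_rk_erase_erase_lt hx hy hxy (by omega) (by omega) (by omega))
    · have hDr' : rk N (((gr N).erase e).erase x) < rk N (gr N) := by
        rw [erase_right_comm]; omega
      exact inCount_five_le_outCount_six_of_twelve_of_seriesPair_mem hn hR
        (seriesPair_of_rk_erase_erase_lt hy hx hxy.symm (by omega) (by omega) hDr')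
  · -- `#D = 3`: a 3-cocircuit through `e`
    have hD3' : D.card = 3 := by omega
    obtain ⟨x, y, z, hxy, hxz, hyz, rfl⟩ := card_eq_three.1 hD3'
    have hx : x ∈ gr N := hD (mem_insert_self x _)
    have hy : y ∈ gr N := hD (mem_insert_of_mem (mem_insert_self y _))
    have hz : z ∈ gr N := hD (mem_insert_of_mem (mem_insert_of_mem (mem_singleton_self z)))
    rw [mem_insert, mem_insert, mem_singleton] at he
    rcases he with rfl | rfl | rfl
    · exact inCount_five_le_outCount_six_of_threeCocircuit_triple hn hR hx hy hz hxy hxz hyz hDr hmin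
    · have hperm : ({x, e, z} : Finset α) = {e, x, z} := insert_comm x e {z}
      rw [hperm] at hDr hmin
      exact inCount_five_le_outCount_six_of_threeCocircuit_triple hn hR hy hx hz hxy.symm hyz hxz hDr hmin
    · have hperm : ({x, y, e} : Finset α) = {e, x, y} := by
        rw [pair_comm y e, insert_comm x e {y}]
      rw [hperm] at hDr hmin
      exact inCount_five_le_outCount_six_of_threeCocircuit_triple hn hR hz hx hy hxz.symm hyz.symm hxy hDr hmin

end ThreeCocircuitC

end PercRepro.Cogirth
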